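import Summits.BirchSwinnertonDyer.BirchSwinnertonDyer.Theorems.AdditiveBranchIMCGordTwoRankOneVisibilityCert
import Summits.BirchSwinnertonDyer.Rank1Residual.Supersingular.X7VisibilityWitnessShape
import HarnessLib

/-!
# Crux `GordTwoRankOne` (item 19358): the rank-ONE visibility door, certificate shape with the place `p` FREE when both
# curves are GOOD at `p` (Mazur–Rubin kind (v)) — for the non-additive rank-one content rows found by the cell-free census

Cell `bsd-addord`, seat `bsd-addord-k1-c3` (D-0074 row B2), gen 7; sibling of `…GordTwoRankOneVisibilityCert.lean`. HONEST FRAMING: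
THEOREMS ONLY (no definition, no named fact, no `sorry`); per-pair inputs are displayed binders; nothing is booked by this file.

## Why

The cell-free census of this gen (kit j265407: all 340 Cremona rank-one classes with `ord₃ #Ш_an = 2` and `E[3]` irreducible) found
17 keys GOOD at `3` with a mod-`3` congruent partner of rank `≥ 2`. With options (a)/(b) only (the §4 door) the place `3` must be paid by
option (a) even when both curves are good at `3`, which costs one witness dimension. Mazur–Rubin 2015 (the UNTWISTED kind (v) of
team b2b's dispatch `Summit.BirchSwinnertonDyer.Rank1Residual.Supersingular.h1Equiv_kummerMapTorsion_mem_selmerLocalKer_of_witness`: `w ∣ p`, both curves good at `w`, named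
fact `selmerLocalKer_iff_of_goodReduction_above`) frees that place. This file threads that third option through the two-witness
theorem: `missingLowerBoundAt_rankOne_irr_of_twoWitnesses_goodAbove` (binders `hCT hGZK hMR` + per-pair data with per-place options
(a) / (b) / (v)). Serves the rank-one content rows of b2b's X-classes good at `p`; NOT a bsd-addord row (those are additive at `p`).

References: Mazur–Rubin 2015 Thm. 3.1 (iv)(b) [MazurRubin2015SelmerCompanions]; Cremona–Mazur 2000 §3 [CremonaMazur2000];
Agashe–Stein 2002 Lemma 3.6 [AgasheStein2002]; Silverman AEC X.4.14 [SilvermanAEC2009].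
-/

set_option autoImplicit false

noncomputable section

open scoped Classical

open WeierstrassCurve Literature.NumberTheory.EllipticCurves
  Literature.NumberTheory.EllipticCurves.Rank1Residual
  Literature.NumberTheory.EllipticCurves.Rank1Residual.Typed
  Literature.NumberTheory.EllipticCurves.MazurRubin2015
  Literature.NumberTheory.GaloisRepresentations
  Summit.BirchSwinnertonDyer.Rank1Residual.GaloisImage
open NumberField IsDedekindDomain Rat.HeightOneSpectrum Field

set_option linter.dupNamespace false

namespace Summit.BirchSwinnertonDyer.BirchSwinnertonDyer.Theorems.AdditiveBranchIMCGordTwoRankOneVisibility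

variable {W : WeierstrassCurve ℚ} [W.IsElliptic] {p : ℕ} [hp : Fact p.Prime]

/-- **`Ш(E)[p] ≠ 0` by two-witness visibility with the place `p` free when both curves are good at `p`** (`E/ℚ` of analytic rank
one with `E[p]` irreducible, `p` odd). Per-place options for each witness:
(a) a `p`-th root in `E'(ℚ_w)`; (b) `w ∤ p` and `E'(ℚ_w)[p] = 0`; (v) `w ∣ p`, both curves good at `w` (Mazur–Rubin, `hMR`).
[cite: MazurRubin2015SelmerCompanions, Thm. 3.1 (iv)(b)] [cite: CremonaMazur2000, §3] [cite: AgasheStein2002, Lemma 3.6] -/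
theorem exists_sha_ne_zero_rankOne_irr_of_twoWitnesses_goodAbove
    (hGZK : rank_eq_analyticRank_of_analyticRank_le_one)
    (hMR : selmerLocalKer_iff_of_goodReduction_above) (hp2 : p ≠ 2)
    (hirr : Irr W p) (hr : W.analyticRank = 1)
    (W' : WeierstrassCurve ℚ) [W'.IsElliptic]
    (θ : geomTorsion W' (p : ℤ) ≃+ geomTorsion W (p : ℤ))
    (hθ : ∀ (σ : absoluteGaloisGroup ℚ) (P : geomTorsion W' (p : ℤ)), θ (σ • P) = σ • θ P)
    (S : Finset (HeightOneSpectrum (𝓞 ℚ)))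
    (hS : ∀ w : HeightOneSpectrum (𝓞 ℚ), w ∉ S →
      W.HasGoodReductionAt w ∧ W'.HasGoodReductionAt w ∧ (p : 𝓞 ℚ) ∉ w.asIdeal)
    (P₁ P₂ : W'.toAffine.Point)
    (hind : ∀ a b : ℤ, a • P₁ + b • P₂ ∈
      (zsmulAddGroupHom (p : ℤ) : W'.toAffine.Point →+ W'.toAffine.Point).range →
      (p : ℤ) ∣ a ∧ (p : ℤ) ∣ b)
    (hdiv : ∀ P ∈ [P₁, P₂], ∀ w ∈ S,
      (∃ Q : (W'.baseChange (w.adicCompletion ℚ)).toAffine.Point,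
        p • Q = WeierstrassCurve.Affine.Point.baseChange (W' := W') ℚ (w.adicCompletion ℚ) P) ∨
      ((p : 𝓞 ℚ) ∉ w.asIdeal ∧ Nat.card (nsmulAddMonoidHom p :
        (W'.baseChange (w.adicCompletion ℚ)).toAffine.Point →+ _).ker = 1) ∨
      ((p : 𝓞 ℚ) ∈ w.asIdeal ∧ W.HasGoodReductionAt w ∧ W'.HasGoodReductionAt w)) :
    ∃ c : W.sha, c ≠ 0 ∧ p • c = 0 := by
  have hpp : p.Prime := hp.out
  have hn : (p : ℤ) ≠ 0 := by exact_mod_cast hpp.ne_zero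
  have hdiv' : ∀ Q : geomPoints W', ∃ R : geomPoints W', (p : ℤ) • R = Q :=
    W'.zsmul_geomPoints_surjective_holds hn
  obtain ⟨G, hG⟩ := exists_generator_rankOne_of_irr (W := W) (p := p) hGZK hirr hr
  refine exists_sha_ne_zero_of_congr_of_two_witnesses W W' hp2 θ hθ S hS hdiv' ⟨G, fun Q ↦ ?_⟩ P₁ P₂
    (fun a b hab ↦ hind a b (by convert hab))
    (fun w hw ↦ Summit.BirchSwinnertonDyer.Rank1Residual.Supersingular.h1Equiv_kummerMapTorsion_mem_selmerLocalKer_of_witness hMR hp2 θ hθ hdiv' P₁ w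
      (hdiv P₁ (by simp) w hw))
    (fun w hw ↦ Summit.BirchSwinnertonDyer.Rank1Residual.Supersingular.h1Equiv_kummerMapTorsion_mem_selmerLocalKer_of_witness hMR hp2 θ hθ hdiv' P₂ w
      (hdiv P₂ (by simp) w hw))
  obtain ⟨a, R, h⟩ := hG Q
  exact ⟨a, R, by convert h⟩

/-- **The LOWER half by two-witness visibility, place `p` free when both curves are good at `p`**: for `E/ℚ` of analytic rank one
with `E[p]` irreducible and `ord_p #Ш(E)_an ≤ 2`, `MissingLowerBoundAt W p` from Cassels–Tate (`hCT`), GZK (`hGZK`), Mazur–Rubin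
kind (v) (`hMR`) and the per-pair data. Per pair; NOT a class theorem. [cite: MazurRubin2015SelmerCompanions, Thm. 3.1 (iv)(b)]
[cite: CremonaMazur2000, §3] [cite: SilvermanAEC2009, Thm. X.4.14] -/
theorem missingLowerBoundAt_rankOne_irr_of_twoWitnesses_goodAbove
    (hCT : exists_casselsTate_pairing (K := ℚ)) (hGZK : rank_eq_analyticRank_of_analyticRank_le_one)
    (hMR : selmerLocalKer_iff_of_goodReduction_above) (hp2 : p ≠ 2)
    (hirr : Irr W p) (hr : W.analyticRank = 1)
    {q : ℚ} (hq : shaAn W = (q : ℂ)) (hv : padicValRat p q ≤ 2)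
    (W' : WeierstrassCurve ℚ) [W'.IsElliptic]
    (θ : geomTorsion W' (p : ℤ) ≃+ geomTorsion W (p : ℤ))
    (hθ : ∀ (σ : absoluteGaloisGroup ℚ) (P : geomTorsion W' (p : ℤ)), θ (σ • P) = σ • θ P)
    (S : Finset (HeightOneSpectrum (𝓞 ℚ)))
    (hS : ∀ w : HeightOneSpectrum (𝓞 ℚ), w ∉ S →
      W.HasGoodReductionAt w ∧ W'.HasGoodReductionAt w ∧ (p : 𝓞 ℚ) ∉ w.asIdeal)
    (P₁ P₂ : W'.toAffine.Point)
    (hind : ∀ a b : ℤ, a • P₁ + b • P₂ ∈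
      (zsmulAddGroupHom (p : ℤ) : W'.toAffine.Point →+ W'.toAffine.Point).range →
      (p : ℤ) ∣ a ∧ (p : ℤ) ∣ b)
    (hdiv : ∀ P ∈ [P₁, P₂], ∀ w ∈ S,
      (∃ Q : (W'.baseChange (w.adicCompletion ℚ)).toAffine.Point,
        p • Q = WeierstrassCurve.Affine.Point.baseChange (W' := W') ℚ (w.adicCompletion ℚ) P) ∨
      ((p : 𝓞 ℚ) ∉ w.asIdeal ∧ Nat.card (nsmulAddMonoidHom p :
        (W'.baseChange (w.adicCompletion ℚ)).toAffine.Point →+ _).ker = 1) ∨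
      ((p : 𝓞 ℚ) ∈ w.asIdeal ∧ W.HasGoodReductionAt w ∧ W'.HasGoodReductionAt w)) :
    MissingLowerBoundAt W p := by
  have hex : ∃ c : W.sha, c ≠ 0 ∧ p • c = 0 :=
    exists_sha_ne_zero_rankOne_irr_of_twoWitnesses_goodAbove hGZK hMR hp2 hirr hr W' θ hθ S hS P₁ P₂ hind hdiv
  have hfinSha : W.ShaFinite := (hGZK W (by rw [hr])).2
  exact missingLowerBoundAt_of_casselsTate_of_pow_dvd W p hCT hfinSha hq (k := 1) (by simpa using hv)
    (by simpa using dvd_shaOrder_of_exists_torsion W p hex)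

end Summit.BirchSwinnertonDyer.BirchSwinnertonDyer.Theorems.AdditiveBranchIMCGordTwoRankOneVisibility

end
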